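import Summits.HodgeConjecture.HodgeConjecture.Theorems.Ring2Hypotheses
import Summits.HodgeConjecture.HodgeConjecture.Theorems.RankFourFacesFaceReductionOfWeilFamily
import HarnessLib

/-!
# Route `RankFourFaces` read through the stage-3 dictionary: `AbelianSchemeVHC ⟹ RankFourWeilTransport`,
# and the whole route from `{AbelianSchemeVHC, MumfordTateCMAnchors, Deligne's CM-product Weil family, AbelianComplement}`

HONEST FRAMING (prover, cell pub-hodgecm2 / COR-CM seat b24 gen 23, count-neutral; theorems only, no definition,
no named fact, no `sorry`; NO case of the Hodge conjecture is proved — every statement below is an implication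
between named hypotheses, or an ON-PATH sanity implication from the summit).  `HC_CM` :=
`Theses.RankFourFaces.CMAbelianHodge` (stmt-HodgeConjecture-3052) is NOT proved here or anywhere.

THE JUNCTION.  The crux `RankFourWeilTransport` (stmt-HodgeConjecture-16265) of the route `RankFourFaces` —
Grothendieck's variational Hodge statement for DEGREE-FOUR classes on smooth projective families of abelian
`4g`-folds with `E`-multiplication (`E = ℚ[T]/(P)` a CM field, `E`-rank `4`) — is, symbol for symbol, the
instance `n := 4g`, `p := 2` of the stage-3 dictionary entry `Ring2.Hypotheses.AbelianSchemeVHC`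
(`Theorems/Ring2Hypotheses.lean` §1a: the variational Hodge conjecture along smooth projective families ALL OF
WHOSE FIBRES ARE ABELIAN VARIETIES, every codimension) with the `E`-structure of the fibres FORGOTTEN:
`rankFourWeilTransport_of_abelianSchemeVHC`.  Hence (bookkeeping, by name, no new mathematics):

* ON PATH: `VariationalHodge ⟹ RankFourWeilTransport`, `HC_AV ⟹ RankFourWeilTransport`,
  `HodgeConjecture ⟹ RankFourWeilTransport` (the crux is a consequence of the summit — the refuter's probe
  `rankFourWeilTransport_of_summit` of the item's CRUX-ATTACK, here landed through the dictionary).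
* `HC_CM ⟸ AbelianSchemeVHC ∧ hF` (`cmAbelianHodge_of_abelianSchemeVHC_of_weilFamily`), where `hF` is the ONE
  displayed construction of the sibling file `RankFourFacesFaceReductionOfWeilFamily.lean` (seat b24 gen 22,
  p258986): Deligne 1982 §5 (c) + proof of Thm. 4.8 — the E-Weil family through every constant-sum product of
  E-CM abelian varieties with a TENSOR FIBRE (local notation `WeilFamilyConstantSumStatement`, copied token for
  token; its algebraic anchor is DISCHARGED in the tree, `weilClassesField_le_algebraicClasses_of_isogenyPair_companion`).
  Compare the dictionary's own row (D) `Ring2.Hypotheses.hc_cm_of_abelianSchemeVHC`, which reaches `HC_CM` from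
  `AbelianSchemeVHC` through THREE printed inputs (`Andre1992_…` — discharged in the tree —,
  `deligne1982_weilFamily_hodgeWeilSection_all` for imaginary quadratic fields, and the CM-field anchored leaf
  `WeilTypeLadder.AnchoredWeilFamiliesCMField`): on this row the two Weil-family inputs are replaced by the
  single rank-four CM-product display `hF`, André 1992 entering through the LANDED stubs B1/B2 of the line
  `birth` of `FaceReduction` (`RankFourWeil.hc_cm_of_rankFourCMProductWeilClassesAlgebraic`).
* `HC_AV ⟸ AbelianSchemeVHC ∧ MumfordTateCMAnchors ∧ hF` and
  `HodgeConjecture ⟸ AbelianSchemeVHC ∧ MumfordTateCMAnchors ∧ hF ∧ AbelianComplement` — the route's deciding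
  theorem `Theses.RankFourFaces.closes` fed BY NAME: `h₂ := rankFourWeilTransport_of_abelianSchemeVHC`,
  `h₃ := RankFourFacesWeilFamily.faceReduction_of_weilFamily hF`,
  `h₄ := Ring2.Hypotheses.cmToAbelian_of_mumfordTateCMAnchors_of_abelianSchemeVHC`, `h₉ := AbelianComplement`.
  So the route `RankFourFaces` has NO hypothesis of its own beyond the stage-3 dictionary
  (`AbelianSchemeVHC`, `MumfordTateCMAnchors`), Deligne's construction `hF`, and the declared complement.

What is NOT here: any discharge of `AbelianSchemeVHC` (open: variational Hodge beyond divisors), of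
`MumfordTateCMAnchors` (Deligne 1982 Prop. 6.1, in print, unformalised), of `hF` (a construction in print:
Riemann, Baily–Borel, `det = 1` level; not on the tree's carriers) or of `AbelianComplement`.

References: [CharlesSchnell2014Notes] Conj. 11.3.1, Thm. 11.5.11, Prop. 11.5.23, Thm. 11.5.24;
[Deligne1982HodgeCycles] Thm. 4.8 and proof, §5 (c), Prop. 6.1, Milne's endnote 19 (2003 re-edition);
[Grothendieck1966] footnote 13; [Andre1992HodgeCM] Théorème.
-/

noncomputable section

-- every declaration of this problem lives in `Summit.HodgeConjecture.HodgeConjecture.…` (summit = sub-problem)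
set_option linter.dupNamespace false

open CategoryTheory CategoryTheory.Limits AlgebraicGeometry MonoidalCategory CartesianMonoidalCategory Polynomial
open Literature.AlgebraicTopology.SingularHomology
open Literature.AlgebraicGeometry Literature.AlgebraicGeometry.Motives Literature.AlgebraicGeometry.HodgeTheory
open Summit.HodgeConjecture.HodgeConjecture.Theses.RankFourFaces
  (CMAbelianHodge RankFourWeilTransport FaceReduction CMToAbelian AbelianComplement)
open Summit.HodgeConjecture.HodgeConjecture.Ring2.Hypotheses (AbelianSchemeVHC MumfordTateCMAnchors)

namespace Summit.HodgeConjecture.HodgeConjecture.Theorems.RankFourFacesVHC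

/-! ## §1 The junction: the crux `RankFourWeilTransport` is an instance of `AbelianSchemeVHC` -/

/-- **`AbelianSchemeVHC ⟹ RankFourWeilTransport`** (crux stmt-HodgeConjecture-16265 of the route `RankFourFaces`
from the stage-3 dictionary entry, by name): a family as in the crux — smooth projective of relative dimension
`4g` over a smooth irreducible base, every fibre `≅ (A', φ')` with `P(φ') = 0` — is in particular a smooth
projective family all of whose fibres are abelian `4g`-folds; apply the variational Hodge statement for abelian
schemes in codimension `p = 2` to the global class `W ∈ H⁴(𝒳(ℂ); ℂ)`.  The `E`-structure and the CM polynomial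
`P` are simply forgotten. [cite: CharlesSchnell2014Notes, Conj. 11.3.1] [cite: Grothendieck1966, footnote 13] -/
theorem rankFourWeilTransport_of_abelianSchemeVHC (hV : AbelianSchemeVHC) : RankFourWeilTransport := by
  intro g _ P _ _ _ _ _ 𝒳 S f hf hirr hsm hfib W hW h₀ s
  have hfib' : ∀ t : ComplexPoints S, ∃ A' : AbelianVariety ℂ, A'.dim = 4 * g ∧ Nonempty (A'.X ≅ fiberOver f t) :=
    fun t => by
      obtain ⟨A', _, hd, -, hi⟩ := hfib t
      exact ⟨A', hd, hi⟩
  exact hV f hf hirr hsm hfib' 2 W hW h₀ s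

/-- ON PATH: the general variational Hodge statement `Theses.AnchorTransport.VariationalHodge` gives the crux
(through `Ring2.Hypotheses.abelianSchemeVHC_of_vhc`). [cite: CharlesSchnell2014Notes, Conj. 11.3.1] -/
theorem rankFourWeilTransport_of_variationalHodge (h : Theses.AnchorTransport.VariationalHodge) :
    RankFourWeilTransport :=
  rankFourWeilTransport_of_abelianSchemeVHC (Ring2.Hypotheses.abelianSchemeVHC_of_vhc h)

/-- ON PATH: the Hodge conjecture for all complex abelian varieties (`Theses.PadicSemiregularLift.HodgeAbelianVarieties`)
gives the crux (apply it on every fibre; through `Ring2.Hypotheses.abelianSchemeVHC_of_hc_av`).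
[cite: CharlesSchnell2014Notes, Cor. 11.3.6] -/
theorem rankFourWeilTransport_of_hodgeAbelianVarieties (h : Theses.PadicSemiregularLift.HodgeAbelianVarieties) :
    RankFourWeilTransport :=
  rankFourWeilTransport_of_abelianSchemeVHC (Ring2.Hypotheses.abelianSchemeVHC_of_hc_av h)

/-- ON PATH: the summit gives the crux — `RankFourWeilTransport` is a CONSEQUENCE of `HodgeConjecture` (so the
crux is consistent relative to the summit; the refuter's probe `rankFourWeilTransport_of_summit` of the item's
CRUX-ATTACK, landed through the dictionary). [cite: CharlesSchnell2014Notes, Cor. 11.3.6] -/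
theorem rankFourWeilTransport_of_hodgeConjecture (h : _root_.HodgeConjecture) : RankFourWeilTransport :=
  rankFourWeilTransport_of_abelianSchemeVHC (Ring2.Hypotheses.abelianSchemeVHC_of_hodgeConjecture h)

/-- ON PATH: the target gives the crux `FaceReduction` (stmt-HodgeConjecture-16266, `RankFourWeilTransport →
CMAbelianHodge`) with its hypothesis idle — as for any reduction crux. [folklore] -/
theorem faceReduction_of_cmAbelianHodge (h : CMAbelianHodge) : FaceReduction := fun _ => h

/-! ## §2 The route from the dictionary and Deligne's CM-product Weil family -/

/-- `WeilFamilyConstantSumStatement` — LOCAL NOTATION ONLY, copied TOKEN FOR TOKEN from the sibling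
`RankFourFacesFaceReductionOfWeilFamily.lean` (so that `hF` below has literally the type consumed by
`RankFourFacesWeilFamily.faceReduction_of_weilFamily`): the statement of Deligne 1982 §5 (c) + proof of Thm. 4.8, (a)–(c) and the flat subsystem, for a CM field
`E = ℚ[T]/(P)` of any degree `2g` and any even E-rank `2k`): through every constant-sum product `(Y, φ, π)` of
`2k` E-CM abelian `g`-folds `(B_i, ψ_i)` (`P(ψ_i) = 0`; constant sum ⟺ every class of
`weilClassesField Y φ P (2k)` is of Hodge type `(k,k)`, [Deligne1982HodgeCycles, Prop. 4.4]) and through every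
rational class `c` of its E-Weil space passes a smooth projective family `f : 𝒳 ⟶ S`, embedded in `ℙᴺ × S`,
over a smooth irreducible quasi-projective base, with fibrewise `ℤ[T]/(P)`-action, a chart `e : Y.X ≅ 𝒳_{s₁}`,
a continuous section `σ` of `FiberClass f (2k)` through `e^{-1*} c` with rational `(k,k)` values, and a tensor
fibre `𝒳_{s₀} ≅ Y₀`, `(Y₀, φ₀)` `E`-isogenous to a companion tensor point `T^{2g}` over an abelian `k`-fold `T`,
with `σ(s₀)` in the E-Weil space of `(Y₀, φ₀)`.
[cite: Deligne1982HodgeCycles, §5 (c) (pp. 38–39) and proof of Thm. 4.8 (pp. 32–35), (a)–(c)]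
[cite: CharlesSchnell2014Notes, Prop. 11.5.22 and Thm. 11.5.24] -/
local notation3 (prettyPrint := false) "WeilFamilyConstantSumStatement" =>
  (∀ (g : ℕ), 1 ≤ g → ∀ (P : Polynomial ℤ), P.Monic → P.natDegree = 2 * g →
    Irreducible (P.map (Int.castRingHom ℚ)) →
    (∀ ρ : ℂ, Polynomial.eval₂ (Int.castRingHom ℂ) ρ P = 0 → ρ.im ≠ 0) →
    (∃ Q : Polynomial ℚ, ∀ ρ : ℂ, Polynomial.eval₂ (Int.castRingHom ℂ) ρ P = 0 →
      Polynomial.aeval ρ Q = (starRingEnd ℂ) ρ) →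
    ∀ (k : ℕ), 1 ≤ k →
    ∀ (B : Fin (2 * k) → Literature.AlgebraicGeometry.Motives.AbelianVariety ℂ) (ψ : ∀ i, B i ⟶ B i),
      (∀ i, (B i).dim = g) →
      (∀ i, Polynomial.eval₂ (Int.castRingHom (CategoryTheory.End (B i)))
        (ψ i : CategoryTheory.End (B i)) P = 0) →
    ∀ (Y : Literature.AlgebraicGeometry.Motives.AbelianVariety ℂ) (φ : Y ⟶ Y) (π : ∀ i, Y ⟶ B i),
      (∀ i, π i ≫ ψ i = φ ≫ π i) →
      Nonempty (CategoryTheory.Limits.IsLimit (CategoryTheory.Limits.Fan.mk Y π)) →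
      Y.dim = 2 * k * g →
      Literature.AlgebraicGeometry.Motives.IsSmoothProjective (2 * k * g) Y.X →
      Polynomial.eval₂ (Int.castRingHom (CategoryTheory.End Y)) (φ : CategoryTheory.End Y) P = 0 →
      (∀ c ∈ Literature.AlgebraicGeometry.HodgeTheory.weilClassesField Y φ P (2 * k),
        Literature.AlgebraicGeometry.HodgeTheory.IsOfHodgeType (2 * k * g) Y.X (2 * k) k k c) →
    ∀ c : Literature.AlgebraicGeometry.HodgeTheory.complexBetti Y.X (2 * k),
      Literature.AlgebraicGeometry.HodgeTheory.IsRationalClass c →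
      c ∈ Literature.AlgebraicGeometry.HodgeTheory.weilClassesField Y φ P (2 * k) →
      ∃ (𝒳 S : Literature.AlgebraicGeometry.Motives.SchemeOver ℂ) (f : 𝒳 ⟶ S)
        (s₁ s₀ : Literature.AlgebraicGeometry.Motives.ComplexPoints S)
        (e : Y.X ≅ Literature.AlgebraicGeometry.Motives.fiberOver f s₁)
        (σ : Literature.AlgebraicGeometry.Motives.ComplexPoints S →
          Literature.AlgebraicGeometry.HodgeTheory.FiberClass f (2 * k)),
        Literature.AlgebraicGeometry.Motives.IsSmoothProjectiveFamily f (2 * k * g) ∧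
        (∃ (N : ℕ) (ι : 𝒳 ⟶ CategoryTheory.MonoidalCategoryStruct.tensorObj
            (Literature.AlgebraicGeometry.Motives.projectiveSpace N ℂ) S),
          AlgebraicGeometry.IsClosedImmersion ι.left ∧
            ι ≫ CategoryTheory.SemiCartesianMonoidalCategory.snd
              (Literature.AlgebraicGeometry.Motives.projectiveSpace N ℂ) S = f) ∧
        IrreducibleSpace S.left ∧ AlgebraicGeometry.Smooth S.hom ∧
        Literature.AlgebraicGeometry.HodgeTheory.IsQuasiProjectiveOver S ∧
        (∀ s : Literature.AlgebraicGeometry.Motives.ComplexPoints S,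
          ∃ (A' : Literature.AlgebraicGeometry.Motives.AbelianVariety ℂ) (φ' : A' ⟶ A'),
            A'.dim = 2 * k * g ∧
            Polynomial.eval₂ (Int.castRingHom (CategoryTheory.End A')) (φ' : CategoryTheory.End A') P = 0 ∧
            Nonempty (A'.X ≅ Literature.AlgebraicGeometry.Motives.fiberOver f s)) ∧
        Continuous σ ∧ (∀ s, (σ s).pt = s) ∧
        (∀ s, Literature.AlgebraicGeometry.HodgeTheory.IsRationalClass (σ s).cls) ∧
        (∀ s, Literature.AlgebraicGeometry.HodgeTheory.IsOfHodgeType (2 * k * g)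
          (Literature.AlgebraicGeometry.Motives.fiberOver f (σ s).pt) (2 * k) k k (σ s).cls) ∧
        σ s₁ = ⟨s₁, Literature.AlgebraicGeometry.HodgeTheory.complexBetti.map e.inv (2 * k) c⟩ ∧
        ∃ (Y₀ : Literature.AlgebraicGeometry.Motives.AbelianVariety ℂ) (φ₀ : Y₀ ⟶ Y₀)
          (e₀ : Y₀.X ≅ Literature.AlgebraicGeometry.Motives.fiberOver f s₀)
          (x : Literature.AlgebraicGeometry.HodgeTheory.complexBetti
            (Literature.AlgebraicGeometry.Motives.fiberOver f s₀) (2 * k)),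
          (∃ (n : ℕ) (T A₀ : Literature.AlgebraicGeometry.Motives.AbelianVariety ℂ) (φT : A₀ ⟶ A₀)
              (q : Fin (n + 1) → (A₀ ⟶ T)) (u : Y₀ ⟶ A₀) (v : A₀ ⟶ Y₀) (m : ℕ),
            n + 1 = 2 * g ∧ T.dim = k ∧ A₀.dim = (n + 1) * k ∧ Y₀.dim = 2 * k * g ∧
            Polynomial.eval₂ (Int.castRingHom (CategoryTheory.End Y₀)) (φ₀ : CategoryTheory.End Y₀) P = 0 ∧
            Nonempty (CategoryTheory.Limits.IsLimit (CategoryTheory.Limits.Fan.mk A₀ q)) ∧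
            φT ≫ q 0 = -(P.coeff 0 • q (Fin.last n)) ∧
            (∀ j : Fin n, φT ≫ q j.succ = q (Fin.castSucc j) - P.coeff ((j : ℕ) + 1) • q (Fin.last n)) ∧
            0 < m ∧ u ≫ v = m • 𝟙 Y₀ ∧ v ≫ φ₀ = φT ≫ v) ∧
          σ s₀ = ⟨s₀, x⟩ ∧
          Literature.AlgebraicGeometry.HodgeTheory.complexBetti.map e₀.hom (2 * k) x ∈
            Literature.AlgebraicGeometry.HodgeTheory.weilClassesField Y₀ φ₀ P (2 * k))

/-- **`HC_CM ⟸ AbelianSchemeVHC ∧ hF`**: the variational Hodge statement for abelian schemes and Deligne's E-Weil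
family through the constant-sum E-CM products (the display `hF`, Deligne 1982 §5 (c) + proof of Thm. 4.8 with a
tensor fibre) give the Hodge conjecture for every complex abelian variety of CM type — `FaceReduction` from `hF`
(`RankFourFacesWeilFamily.faceReduction_of_weilFamily`: stub A from `hF`, stubs B2/B1 = 2001 lattice + André 1992
LANDED) applied to `rankFourWeilTransport_of_abelianSchemeVHC`.  CONDITIONAL on two open/unformalised inputs;
nothing is closed. [cite: Deligne1982HodgeCycles, §5 (c) and proof of Thm. 4.8]
[cite: CharlesSchnell2014Notes, Conj. 11.3.1 and Thm. 11.5.24] [cite: Andre1992HodgeCM, Théorème] -/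
theorem cmAbelianHodge_of_abelianSchemeVHC_of_weilFamily (hV : AbelianSchemeVHC)
    (hF : WeilFamilyConstantSumStatement) : CMAbelianHodge :=
  RankFourFacesWeilFamily.faceReduction_of_weilFamily hF (rankFourWeilTransport_of_abelianSchemeVHC hV)

/-- **`HC_AV ⟸ AbelianSchemeVHC ∧ MumfordTateCMAnchors ∧ hF`** — Milne's endnote-19 theorem
(`AbelianSchemeVHC ⟹ HC` for all abelian varieties) on the rank-four row: the dictionary's
`hc_av_of_hc_cm_of_mumfordTateCMAnchors_of_abelianSchemeVHC` fed with `HC_CM` from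
`cmAbelianHodge_of_abelianSchemeVHC_of_weilFamily`; compared with the dictionary's row (M)
`Ring2.Hypotheses.hc_av_of_abelianSchemeVHC`, the printed inputs `deligne1982_weilFamily_hodgeWeilSection_all` and
`WeilTypeLadder.AnchoredWeilFamiliesCMField` are replaced by the single rank-four CM-product display `hF`, and
André 1992 is consumed as a tree theorem. CONDITIONAL; nothing is closed.
[cite: Deligne1982HodgeCycles, Prop. 6.1 and Milne 2003 re-edition endnote 19]
[cite: CharlesSchnell2014Notes, Thm. 11.5.11 and Conj. 11.3.1] -/
theorem hodgeAbelianVarieties_of_abelianSchemeVHC_of_mumfordTateCMAnchors_of_weilFamily (hV : AbelianSchemeVHC)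
    (hAn : MumfordTateCMAnchors) (hF : WeilFamilyConstantSumStatement) :
    Theses.PadicSemiregularLift.HodgeAbelianVarieties :=
  Ring2.Hypotheses.hc_av_of_hc_cm_of_mumfordTateCMAnchors_of_abelianSchemeVHC
    (cmAbelianHodge_of_abelianSchemeVHC_of_weilFamily hV hF) hAn hV

/-- **The route `RankFourFaces` from the dictionary**: `HodgeConjecture ⟸ AbelianSchemeVHC ∧ MumfordTateCMAnchors ∧
hF ∧ AbelianComplement` — the route's DECIDING THEOREM `Theses.RankFourFaces.closes` with every route hypothesis
supplied BY NAME: `h₂` (RankFourWeilTransport) := `rankFourWeilTransport_of_abelianSchemeVHC`, `h₃` (FaceReduction)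
:= `RankFourFacesWeilFamily.faceReduction_of_weilFamily hF`, `h₄` (CMToAbelian) :=
`Ring2.Hypotheses.cmToAbelian_of_mumfordTateCMAnchors_of_abelianSchemeVHC`, `h₉` := the declared complement
(stmt-HodgeConjecture-15889, the Hodge conjecture off the abelian varieties). CONDITIONAL on four open /
unformalised inputs; the summit is NOT proved. [cite: CharlesSchnell2014Notes, Conj. 11.3.1, Thm. 11.5.11 and Thm. 11.5.24]
[cite: Deligne1982HodgeCycles, §5 (c), proof of Thm. 4.8 and Prop. 6.1] -/
theorem hodgeConjecture_of_abelianSchemeVHC_of_mumfordTateCMAnchors_of_weilFamily_of_abelianComplement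
    (hV : AbelianSchemeVHC) (hAn : MumfordTateCMAnchors) (hF : WeilFamilyConstantSumStatement)
    (hC : AbelianComplement) : _root_.HodgeConjecture :=
  Theses.RankFourFaces.closes (rankFourWeilTransport_of_abelianSchemeVHC hV)
    (RankFourFacesWeilFamily.faceReduction_of_weilFamily hF)
    (Ring2.Hypotheses.cmToAbelian_of_mumfordTateCMAnchors_of_abelianSchemeVHC hAn hV) hC

end Summit.HodgeConjecture.HodgeConjecture.Theorems.RankFourFacesVHC

end
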